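import Mathlib.RingTheory.Localization.NumDen
import Mathlib.RingTheory.Localization.FractionRing
import Mathlib.RingTheory.Localization.Integer
import Mathlib.Algebra.Module.LinearMap.Defs
import Mathlib.Tactic.Ring
import HarnessLib

/-!
# Uniqueness of normalised Coleman maps: two normalisations of a `p`-adic `L`-function that both generate

Pure commutative algebra, sorry-free, companion to `IwasawaDivisibilityTransfer.lean` (same
namespace), extracted for the cell `bsd-ssimc` (seat `bsd-ssimc-bstw`, memo `bstw-MEMO-8`) while
checking that the two-variable `p`-adic `L`-functions of Burungale–Skinner–Tian–Wan
(arXiv:2409.01350v2, Part I Thms. 4.10/4.11 and §4.5.1: `𝓛_v(g/L) ∈ Λ`, `𝓛_p^{Gr}(g/L) ∈ Λ^{ur}`)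
generate the SAME ideals as those of Castella–Grossi–Skinner (Math. Ann. 2025 = arXiv:2303.04373,
Defs. 1.2.2/1.4.3: `L_p^{PR}(E/K)`, `L_p^{Gr}(f/K)`), which is what Burungale–Castella–Skinner
(IMRN 2025, Thm. 4.1.3) need when they cite BSTW §9.3.2 for CGS-normalised functions.

The mechanism. In both papers the `p`-adic `L`-function is the VALUE `C(z)` of one global class `z`
under a `Λ`-linear local map `C : H → Frac Λ` (a "Coleman / big-logarithm map" composed with a
trivialisation of a rank-one Dieudonné module and multiplied by a normalising constant), and the
normalisation is chosen so that the image of `C` is (up to a pseudo-null module) ALL of `Λ`. Two such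
maps on the same rank-one source differ by a scalar `u ∈ Frac Λ` (`C' = u • C`). The lemmas below say:
if both maps take integral values and the image of each contains two relatively prime elements of the
UFD `Λ` (this is what "cokernel pseudo-null" supplies over `Λ = ℤ_p⟦T₁,T₂⟧`: an ideal not contained in
any height-one prime of a UFD contains two coprime elements), then `u` is a UNIT of `Λ`; hence
`C(z)` and `C'(z)` are associated for every `z`, i.e. generate the same principal ideal, WITHOUT any
comparison of interpolation formulas. The memo then only has to compare the two normalising recipes
(a constant on the cyclotomic/`PR` side, the cuspidal congruence power series of the canonical CM
family on the Greenberg side).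

* `isInteger_of_isRelPrime_of_isInteger_mul` — in the fraction field of a UFD, if `a·x` and `b·x` are
  integral for relatively prime `a, b`, then `x` is integral (reduced-fraction argument).
* `exists_unit_eq_of_linearMap_eq_smul` — the uniqueness statement: `C' = u • C`, both integral-valued,
  each image containing a coprime pair `⇒ u ∈ Λˣ`.
* `associated_of_linearMap_eq_smul` — consequence for the two values of one class: they are associated.

What is NOT here: that BSTW's and CGS's maps satisfy the hypotheses (that is BSTW I §4.3.3/§4.5.1 +
Kings–Loeffler–Zerbes Camb. J. Math. 2017 Rem. 8.2.4 on one side, CGS Cor. 3.1.3 on the other; see the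
memo), nor anything about `p`-adic `L`-functions. References: BSTW arXiv:2409.01350v2 §§4.3.3, 4.5.1;
CGS arXiv:2303.04373 §§1.2, 1.4, Cor. 3.1.3; BCS arXiv:2405.00270v2 Thm. 4.1.3.
-/

namespace Literature.NumberTheory.EllipticCurves.IwasawaTransfer

open IsLocalization

section UniqueNormalisation

variable {A : Type*} [CommRing A] [IsDomain A] [UniqueFactorizationMonoid A]
variable {K : Type*} [Field K] [Algebra A K] [IsFractionRing A K]

/-- In the fraction field `K` of a UFD `A`: if the reduced denominator of `x` divides every `c` with
`c·x` integral. Auxiliary. [cite: CastellaGrossiSkinner2025, Cor. 3.1.3 (proof: the normalised Coleman maps `Col_{E•} = deg(π•)·H_p(f)·C̃ol_f`, `Col_𝐠 = h_K·𝓛_v(K)^−·C̃ol_𝐠` have pseudo-null cokernel; auxiliary ring-theoretic step only)] -/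
theorem den_dvd_of_isInteger_mul {x : K} {c : A}
    (hc : IsInteger A (algebraMap A K c * x)) : (IsFractionRing.den A x : A) ∣ c := by
  obtain ⟨r, hr⟩ := hc
  have hx := IsFractionRing.mk'_num_den' A x
  have hden : algebraMap A K (IsFractionRing.den A x : A) ≠ 0 :=
    IsFractionRing.to_map_ne_zero_of_mem_nonZeroDivisors (IsFractionRing.den A x).2
  have hnum : algebraMap A K (IsFractionRing.num A x) = x * algebraMap A K (IsFractionRing.den A x : A) :=
    (div_eq_iff hden).mp hx
  have key : c * IsFractionRing.num A x = (IsFractionRing.den A x : A) * r := by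
    apply FaithfulSMul.algebraMap_injective A K
    rw [map_mul, map_mul, hnum, hr]
    ring
  exact (IsFractionRing.num_den_reduced A x).symm.dvd_of_dvd_mul_right ⟨r, key⟩

/-- **Coprime integral multiples force integrality.** In the fraction field of a UFD, if `a·x` and
`b·x` are integral and `a, b` are relatively prime, then `x` is integral. (The reduced denominator of
`x` divides both `a` and `b`, hence is a unit.) This is the form in which "an element of `Frac Λ`
that multiplies an ideal of height `≥ 2` into `Λ` lies in `Λ`" is used for `Λ = ℤ_p⟦T₁,T₂⟧`.
[cite: BurungaleSkinnerTianWan2024, Part I §3.2.5 (reflexive closures over the two-dimensional regular local ring `Λ_L^v`: `⋂_{P ∈ ht₁} M_P`; ring-theoretic step only; PREPRINT)] -/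
theorem isInteger_of_isRelPrime_of_isInteger_mul {x : K} {a b : A} (hab : IsRelPrime a b)
    (ha : IsInteger A (algebraMap A K a * x)) (hb : IsInteger A (algebraMap A K b * x)) :
    IsInteger A x :=
  IsFractionRing.isInteger_of_isUnit_den (A := A)
    (hab (den_dvd_of_isInteger_mul ha) (den_dvd_of_isInteger_mul hb))

variable {M : Type*} [AddCommGroup M] [Module A M]

/-- **Uniqueness of a normalised Coleman map up to a unit.** Let `C, C' : M → K = Frac A` be
`A`-linear maps that differ by a scalar `u ∈ K` (`C' m = u · C m` for all `m` — automatic when `M`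
has generic rank one and both maps are injective), both taking values in `A`, and suppose the image of
`C` contains two relatively prime elements `a, b` of `A` and the image of `C'` contains two relatively
prime elements `a', b'`. Then `u` is (the image of) a unit of `A`. For BSTW/CGS: "injective with
pseudo-null cokernel into `Λ`" for both normalised maps gives the coprime pairs; the conclusion is that
the two normalisations differ by `Λˣ`. [cite: BurungaleCastellaSkinner2025, Thm. 4.1.3 (proof "shown in [BSTW23, §9.3.2] (cf. [CGS23, Prop. 3.2.1])": transfer from BSTW's `𝓛_v`, `𝓛_p^{Gr}` to the CGS-normalised `L_p^{PR}`, `L_p^{Gr}` of [CGS23, §§1.2, 1.4]; ring-theoretic step only)] [cite: CastellaGrossiSkinner2025, Cor. 3.1.3 (normalised Coleman maps with pseudo-null cokernel; ring-theoretic step only)] -/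
theorem exists_unit_eq_of_linearMap_eq_smul (C C' : M →ₗ[A] K) (u : K)
    (hu : ∀ m, C' m = u * C m)
    (hC : ∀ m, IsInteger A (C m)) (hC' : ∀ m, IsInteger A (C' m))
    {a b a' b' : A} (hab : IsRelPrime a b) (hab' : IsRelPrime a' b')
    (ha : algebraMap A K a ∈ Set.range C) (hb : algebraMap A K b ∈ Set.range C)
    (ha' : algebraMap A K a' ∈ Set.range C') (hb' : algebraMap A K b' ∈ Set.range C') :
    ∃ v : Aˣ, algebraMap A K (v : A) = u := by
  classical
  obtain ⟨ma, hma⟩ := ha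
  obtain ⟨mb, hmb⟩ := hb
  obtain ⟨ma', hma'⟩ := ha'
  obtain ⟨mb', hmb'⟩ := hb'
  -- Step 1: `u` is integral, because `a·u = C' ma` and `b·u = C' mb` are.
  have hau : IsInteger A (algebraMap A K a * u) := by
    have : algebraMap A K a * u = C' ma := by rw [hu ma, hma, mul_comm]
    rw [this]; exact hC' ma
  have hbu : IsInteger A (algebraMap A K b * u) := by
    have : algebraMap A K b * u = C' mb := by rw [hu mb, hmb, mul_comm]
    rw [this]; exact hC' mb
  obtain ⟨r, hr⟩ := isInteger_of_isRelPrime_of_isInteger_mul hab hau hbu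
  -- Step 2: `u ≠ 0`, because otherwise `a' = b' = 0`, contradicting `IsRelPrime a' b'`.
  have hu0 : u ≠ 0 := by
    intro h0
    have hz : ∀ m, C' m = 0 := fun m => by rw [hu m, h0, zero_mul]
    have ha'0 : a' = 0 := by
      apply FaithfulSMul.algebraMap_injective A K
      rw [map_zero, ← hma', hz]
    have hb'0 : b' = 0 := by
      apply FaithfulSMul.algebraMap_injective A K
      rw [map_zero, ← hmb', hz]
    have : IsUnit (0 : A) := hab' (by rw [ha'0]) (by rw [hb'0])
    exact not_isUnit_zero this
  -- Step 3: `u⁻¹` is integral, because `a'·u⁻¹ = C ma'` and `b'·u⁻¹ = C mb'` are.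
  have hau' : IsInteger A (algebraMap A K a' * u⁻¹) := by
    have : algebraMap A K a' * u⁻¹ = C ma' := by
      rw [← hma', hu ma', mul_comm u (C ma'), mul_assoc, mul_inv_cancel₀ hu0, mul_one]
    rw [this]; exact hC ma'
  have hbu' : IsInteger A (algebraMap A K b' * u⁻¹) := by
    have : algebraMap A K b' * u⁻¹ = C mb' := by
      rw [← hmb', hu mb', mul_comm u (C mb'), mul_assoc, mul_inv_cancel₀ hu0, mul_one]
    rw [this]; exact hC mb'
  obtain ⟨s, hs⟩ := isInteger_of_isRelPrime_of_isInteger_mul hab' hau' hbu'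
  -- Step 4: `r * s = 1`, so `r` is a unit with image `u`.
  have hrs : r * s = 1 := by
    apply FaithfulSMul.algebraMap_injective A K
    rw [map_mul, hr, hs, map_one, mul_inv_cancel₀ hu0]
  exact ⟨Units.mkOfMulEqOne r s hrs, by simp [hr]⟩

/-- **The two values of one class are associated.** In the situation of
`exists_unit_eq_of_linearMap_eq_smul`, if `z : M` has `C z = L` and `C' z = L'` (images of elements of
`A`), then `L` and `L'` are associated in `A`: the two normalised `p`-adic `L`-functions obtained from
ONE global class generate the same principal ideal. [cite: BurungaleCastellaSkinner2025, Thm. 4.1.3 (proof: `(L_p^{PR}(g/K)) = (θ𝓛_v(g/L))` and `(L_p^{Gr}(g/K)) = (𝓛_p^{Gr}(g/L))` as ideals, the identification under which BSTW §9.3.2 applies to CGS-normalised functions; ring-theoretic step only)] -/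
theorem associated_of_linearMap_eq_smul (C C' : M →ₗ[A] K) (u : K)
    (hu : ∀ m, C' m = u * C m)
    (hC : ∀ m, IsInteger A (C m)) (hC' : ∀ m, IsInteger A (C' m))
    {a b a' b' : A} (hab : IsRelPrime a b) (hab' : IsRelPrime a' b')
    (ha : algebraMap A K a ∈ Set.range C) (hb : algebraMap A K b ∈ Set.range C)
    (ha' : algebraMap A K a' ∈ Set.range C') (hb' : algebraMap A K b' ∈ Set.range C')
    {z : M} {L L' : A} (hL : C z = algebraMap A K L) (hL' : C' z = algebraMap A K L') :
    Associated L L' := by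
  obtain ⟨v, hv⟩ :=
    exists_unit_eq_of_linearMap_eq_smul C C' u hu hC hC' hab hab' ha hb ha' hb'
  refine ⟨v, ?_⟩
  apply FaithfulSMul.algebraMap_injective A K
  rw [map_mul, hv, ← hL', hu z, hL, mul_comm]

end UniqueNormalisation

end Literature.NumberTheory.EllipticCurves.IwasawaTransfer
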